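import Mathlib
import Literature.Computation.Certificates.SemidefiniteComplementarity
import HarnessLib

/-!
# Pataki's rank bound for extreme matrices of a semidefinite program (Pataki 1998, Theorem 2.1 (1))

Source: G. Pataki, *On the rank of extreme matrices in semidefinite programs and the multiplicity of optimal
eigenvalues*, Math. Oper. Res. 23 (1998) 339–358 [Pataki1998]: §1 "Notation and preliminaries" (`t(n) = n(n+1)/2`
the `n`-th triangular number; faces and extreme points of a closed convex set; the primal SDP (1.1)
`Min C • X s.t. X ⪰ 0, Aᵢ • X = bᵢ (i = 1, …, m)`), §2 Theorem 2.1 part 1 and its proof, equations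
(2.3)–(2.6). (The rank phenomenon for *feasibility* goes back to Barvinok (1995); we formalise Pataki's
statement and proof.)

THE THEOREM (Thm 2.1 (1) in the case `d = dim F = 0`, i.e. `F = {X}` is an extreme point — "a vertex or an
extreme point of S is a face consisting of a single element", §1): if `X` is an extreme point of the feasible
set `𝓕 = {X ⪰ 0 : ⟨Aᵢ, X⟩ = bᵢ (i ∈ ι)}` of (1.1) and `rank X = r`, then `t(r) ≤ m = |ι|`.

CERTIFICATE FORM. Exactly as in the paper's proof ("Since `rank X = r`, we can write `X = QΛQᵀ` where
`Q ∈ ℝ^{n×r}`, `Λ ∈ S^r`, `Λ ≻ 0`", (2.3)) the rank enters only through a FACTORISATION, which we take as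
data: `X = V Λ Vᵀ` with `Λ ≻ 0` of order `r` and `V : n × r` of full column rank, the latter witnessed by a
left inverse `L V = 1` (so that `r = rank X`; a checker verifies `L V = 1` and `Λ ≻ 0` exactly, e.g. over `ℚ`).
Conclusion: `t(r) = r(r+1)/2 ≤ |ι|` (`tri_le_card_of_mem_extremePoints`), equivalently `r(r+1) ≤ 2|ι|`
(`rank_mul_succ_le_two_mul_card`); for a single constraint (e.g. the spectraplex `tr X = 1`) every
extreme point so presented has `r ≤ 1` (`rank_le_one_of_card_le_one`).

THE PROOF (the paper's, (2.4)–(2.6)). The constraints read `⟨VᵀAᵢV, Λ⟩ = bᵢ` ((2.4), `frob_conj`). A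
symmetric `Δ ≠ 0` with `⟨VᵀAᵢV, Δ⟩ = 0` for all `i` ((2.5)) yields, since `Λ ≻ 0`, an `ε > 0` with
`Λ ± εΔ ≻ 0` (`exists_posDef_add_sub_smul`; compactness of the unit sphere), hence two feasible points
`X_± = V(Λ ± εΔ)Vᵀ` ((2.6)) with `X = ½(X_+ + X_-)` and `X_+ ≠ X_-` (because `L(VΔVᵀ)Lᵀ = Δ ≠ 0`):
`exists_ne_of_ker` — so `X` is not extreme. Positively: at an extreme point the linear map
`Δ ↦ (⟨VᵀAᵢV, Δ⟩)ᵢ` (`constraintMap`) is injective on symmetric matrices (`eq_zero_of_mem_extremePoints`);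
composing with the explicit linear injection `symOf : ℝ^{t(r)} → S^r` filling the upper triangle (the
paper's "dim S^r = t(r)", here `card_upperPair`) gives an injective linear map `ℝ^{t(r)} → ℝ^ι`, whence
`t(r) ≤ |ι|` by comparing dimensions. The contrapositive with the dimension count done by
`LinearMap.ker_ne_bot_of_finrank_lt` is the PURIFICATION STEP `exists_ne_of_card_lt_tri`: a feasible
`VΛVᵀ` with `t(r) > |ι|` is the midpoint of two distinct feasible points. §6 runs the contrapositive on the
barycentre `½I₂` of the spectraplex `{X ⪰ 0 : tr X = 1}` in `S²` (`r = 2`, `t(2) = 3 > 1 = m`: not extreme); §7 instantiates the theorem for the elliptope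
`{X ⪰ 0 : X_{ii} = 1}` of correlation matrices (`m = n`: extreme points have `t(r) ≤ n`).

NOT HERE: Thm 2.1 (1) for faces of positive dimension (`t(r) ≤ m + dim F`) and (2) (dual slack matrices),
Thm 2.2 (several semidefinite blocks and free variables), §§3–6 (multiplicity of optimal eigenvalues); the
existence of extreme points (for bounded spectrahedra Mathlib's `IsCompact.extremePoints_nonempty` applies)
and the spectral factorisation `X = VΛVᵀ` itself, which is certificate data here. The trace pairing `frob`
and `IsPrimalFeasible` are those of `SemidefiniteComplementarity`.
-/

noncomputable section

namespace Literature.Computation.Certificates.PatakiRankBound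

open Matrix Finset
open SemidefiniteComplementarity (frob IsPrimalFeasible)

variable {n : Type*} [Fintype n] {ι : Type*}
variable {ρ : Type*} [Fintype ρ]

/-! ## §1 Triangular numbers; coordinates of symmetric matrices (`dim S^r = t(r)`) -/

/-- `t(r) = r(r+1)/2`, "the `r`-th triangular number" (`= dim S^r`). [cite: Pataki1998, §1 Notation (t(n) = ½n(n+1))] -/
def tri (r : ℕ) : ℕ := r * (r + 1) / 2

/-- `2 · Σ_{i<r} (i+1) = r(r+1)`. [folklore] -/
private theorem sum_range_succ_mul_two (r : ℕ) : (∑ i ∈ range r, (i + 1)) * 2 = r * (r + 1) := by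
  induction r with
  | zero => simp
  | succ r ih => rw [sum_range_succ, add_mul, ih]; ring

/-- `t(r) = Σ_{i<r} (i+1)` (so the division in `r(r+1)/2` is exact). [cite: Pataki1998, §1 Notation (t(n) = ½n(n+1))] -/
theorem tri_eq_sum (r : ℕ) : tri r = ∑ i ∈ range r, (i + 1) := by
  unfold tri
  rw [← sum_range_succ_mul_two, Nat.mul_div_cancel _ two_pos]

/-- `2 t(r) = r(r+1)`. [cite: Pataki1998, §1 Notation (t(n) = ½n(n+1))] -/
theorem two_mul_tri (r : ℕ) : 2 * tri r = r * (r + 1) := by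
  rw [tri_eq_sum, mul_comm, sum_range_succ_mul_two]

/-- The index set `{(j, k) : j ≤ k}` of the upper triangle of an `r × r` matrix — coordinates on `S^r`.
[cite: Pataki1998, §2 proof of Thm. 2.1 ("dim S^r = t(r)")] -/
abbrev UpperPair (r : ℕ) : Type := {p : Fin r × Fin r // p.1 ≤ p.2}

/-- `{(j,k) : j ≤ k < r} ≃ Σ_{k<r} {0, …, k}`. [folklore] -/
private def upperPairEquivSigma (r : ℕ) : UpperPair r ≃ Σ k : Fin r, Fin (k + 1) where
  toFun p := ⟨p.1.2, ⟨p.1.1, Nat.lt_succ_of_le p.2⟩⟩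
  invFun q := ⟨(⟨q.2, lt_of_lt_of_le q.2.2 q.1.2⟩, q.1), Nat.le_of_lt_succ q.2.2⟩
  left_inv p := by
    rcases p with ⟨⟨j, k⟩, h⟩
    rfl
  right_inv q := by
    rcases q with ⟨k, ⟨j, hj⟩⟩
    rfl

/-- "`dim S^r = t(r)`": the upper triangle of an `r × r` matrix has `t(r)` entries.
[cite: Pataki1998, §2 proof of Thm. 2.1 ("dim S^r = t(r)")] -/
theorem card_upperPair (r : ℕ) : Fintype.card (UpperPair r) = tri r := by
  rw [Fintype.card_congr (upperPairEquivSigma r), Fintype.card_sigma, tri_eq_sum,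
    ← Fin.sum_univ_eq_sum_range (fun i => i + 1) r]
  simp

/-- The symmetric matrix with prescribed upper-triangular coordinates `e` (the coordinate map `ℝ^{t(r)} → S^r`).
[cite: Pataki1998, §2 proof of Thm. 2.1 ("dim S^r = t(r)")] -/
def symOf {r : ℕ} (e : UpperPair r → ℝ) : Matrix (Fin r) (Fin r) ℝ :=
  fun j k => if h : j ≤ k then e ⟨(j, k), h⟩ else e ⟨(k, j), (not_le.mp h).le⟩

/-- Entries on and above the diagonal. [cite: Pataki1998, §2 proof of Thm. 2.1 ("dim S^r = t(r)")] -/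
theorem symOf_apply_of_le {r : ℕ} (e : UpperPair r → ℝ) {j k : Fin r} (h : j ≤ k) :
    symOf e j k = e ⟨(j, k), h⟩ := by
  simp [symOf, h]

/-- Entries below the diagonal mirror those above. [cite: Pataki1998, §2 proof of Thm. 2.1 ("dim S^r = t(r)")] -/
theorem symOf_apply_of_lt {r : ℕ} (e : UpperPair r → ℝ) {j k : Fin r} (h : k < j) :
    symOf e j k = e ⟨(k, j), h.le⟩ := by
  simp [symOf, not_le.mpr h]

/-- `symOf e` is symmetric. [cite: Pataki1998, §2 proof of Thm. 2.1 ("dim S^r = t(r)")] -/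
theorem isHermitian_symOf {r : ℕ} (e : UpperPair r → ℝ) : (symOf e).IsHermitian := by
  refine Matrix.IsHermitian.ext fun j k => ?_
  rw [star_trivial]
  rcases lt_trichotomy j k with h | h | h
  · rw [symOf_apply_of_lt e h, symOf_apply_of_le e h.le]
  · subst h
    rfl
  · rw [symOf_apply_of_le e h.le, symOf_apply_of_lt e h]

/-- The coordinate map `e ↦ symOf e` is linear. [cite: Pataki1998, §2 proof of Thm. 2.1 ("dim S^r = t(r)")] -/
def symOfLin (r : ℕ) : (UpperPair r → ℝ) →ₗ[ℝ] Matrix (Fin r) (Fin r) ℝ where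
  toFun := symOf
  map_add' e₁ e₂ := by
    ext j k
    by_cases h : j ≤ k
    · simp [symOf_apply_of_le _ h]
    · simp [symOf_apply_of_lt _ (not_le.mp h)]
  map_smul' c e := by
    ext j k
    by_cases h : j ≤ k
    · simp [symOf_apply_of_le _ h]
    · simp [symOf_apply_of_lt _ (not_le.mp h)]

/-- `symOfLin r e = symOf e`. [cite: Pataki1998, §2 proof of Thm. 2.1 ("dim S^r = t(r)")] -/
@[simp] theorem symOfLin_apply {r : ℕ} (e : UpperPair r → ℝ) : symOfLin r e = symOf e := rfl

/-- The coordinate map is injective (the coordinates are read off the upper triangle).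
[cite: Pataki1998, §2 proof of Thm. 2.1 ("dim S^r = t(r)")] -/
theorem symOf_injective (r : ℕ) : Function.Injective (symOf (r := r)) := by
  intro e₁ e₂ h
  funext p
  rcases p with ⟨⟨j, k⟩, hjk⟩
  have := congr_fun (congr_fun h j) k
  rwa [symOf_apply_of_le e₁ hjk, symOf_apply_of_le e₂ hjk] at this

/-! ## §2 The feasible set of (1.1) and the reduced data `VᵀAᵢV` -/

/-- The feasible set `𝓕 = {X ⪰ 0 : Aᵢ • X = bᵢ}` of the primal SDP (1.1), as a set of matrices.
[cite: Pataki1998, §1 (1.1)] -/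
def feasibleSet (A : ι → Matrix n n ℝ) (b : ι → ℝ) : Set (Matrix n n ℝ) := {X | IsPrimalFeasible A b X}

/-- Membership in `𝓕`. [cite: Pataki1998, §1 (1.1)] -/
theorem mem_feasibleSet_iff {A : ι → Matrix n n ℝ} {b : ι → ℝ} {X : Matrix n n ℝ} :
    X ∈ feasibleSet A b ↔ X.PosSemidef ∧ ∀ i, frob (A i) X = b i :=
  Iff.rfl

/-- The trace pairing is additive in the second slot. [folklore] -/
private theorem frob_add_right (M X Y : Matrix n n ℝ) : frob M (X + Y) = frob M X + frob M Y := by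
  simp [frob, Matrix.mul_add, trace_add]

/-- The trace pairing is homogeneous in the second slot. [folklore] -/
private theorem frob_smul_right (M : Matrix n n ℝ) (c : ℝ) (X : Matrix n n ℝ) : frob M (c • X) = c * frob M X := by
  simp [frob, Matrix.mul_smul, trace_smul]

/-- `𝓕` is convex ("Let S be a closed convex set …" — the feasible set of (1.1) is one).
[cite: Pataki1998, §1 (1.1) and Notation (Convex analysis)] -/
theorem convex_feasibleSet (A : ι → Matrix n n ℝ) (b : ι → ℝ) : Convex ℝ (feasibleSet A b) := by
  intro X hX Y hY a c ha hc hac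
  refine ⟨(hX.1.smul ha).add (hY.1.smul hc), fun i => ?_⟩
  rw [frob_add_right, frob_smul_right, frob_smul_right, hX.2 i, hY.2 i, ← add_mul, hac, one_mul]

/-- (2.4): `Aᵢ • (QΛQᵀ) = (QᵀAᵢQ) • Λ` — the constraints in terms of the reduced data `VᵀAᵢV`.
[cite: Pataki1998, §2 proof of Thm. 2.1, eq. (2.4)] -/
theorem frob_conj (M : Matrix n n ℝ) (V : Matrix n ρ ℝ) (Z : Matrix ρ ρ ℝ) :
    frob M (V * Z * Vᵀ) = frob (Vᵀ * M * V) Z := by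
  unfold frob
  rw [show M * (V * Z * Vᵀ) = (M * V * Z) * Vᵀ by simp [Matrix.mul_assoc], trace_mul_comm,
    show Vᵀ * (M * V * Z) = Vᵀ * M * V * Z by simp [Matrix.mul_assoc]]

/-- The reduced constraint map `Δ ↦ (⟨VᵀAᵢV, Δ⟩)ᵢ : ℝ^{ρ×ρ} → ℝ^ι` (the linear system (2.4)/(2.5)), linear.
[cite: Pataki1998, §2 proof of Thm. 2.1, eqs. (2.4)–(2.5)] -/
def constraintMap (A : ι → Matrix n n ℝ) (V : Matrix n ρ ℝ) : Matrix ρ ρ ℝ →ₗ[ℝ] (ι → ℝ) where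
  toFun Δ i := frob (Vᵀ * A i * V) Δ
  map_add' Δ₁ Δ₂ := by
    ext i
    simp [frob, Matrix.mul_add, trace_add]
  map_smul' c Δ := by
    ext i
    simp [frob, trace_smul]

/-- `constraintMap A V Δ i = ⟨VᵀAᵢV, Δ⟩`. [cite: Pataki1998, §2 proof of Thm. 2.1, eqs. (2.4)–(2.5)] -/
@[simp] theorem constraintMap_apply (A : ι → Matrix n n ℝ) (V : Matrix n ρ ℝ) (Δ : Matrix ρ ρ ℝ) (i : ι) :
    constraintMap A V Δ i = frob (Vᵀ * A i * V) Δ := rfl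

/-- (2.4) for a feasible `VZVᵀ`: the reduced constraint map takes the value `b` at `Z`.
[cite: Pataki1998, §2 proof of Thm. 2.1, eq. (2.4)] -/
theorem constraintMap_eq_of_mem {A : ι → Matrix n n ℝ} {b : ι → ℝ} {V : Matrix n ρ ℝ} {Z : Matrix ρ ρ ℝ}
    (h : V * Z * Vᵀ ∈ feasibleSet A b) : constraintMap A V Z = b := by
  funext i
  rw [constraintMap_apply, ← frob_conj]
  exact h.2 i

/-- Conversely a positive semidefinite `Z` with reduced constraint values `b` lifts to the feasible point `VZVᵀ`
(the matrices `X_{j,1}, X_{j,2}` of (2.6) "are feasible for (1.1)"). [cite: Pataki1998, §2 proof of Thm. 2.1, eq. (2.6)] -/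
theorem conj_mem_feasibleSet {A : ι → Matrix n n ℝ} {b : ι → ℝ} {V : Matrix n ρ ℝ} {Z : Matrix ρ ρ ℝ}
    (hZ : Z.PosSemidef) (hb : constraintMap A V Z = b) : V * Z * Vᵀ ∈ feasibleSet A b := by
  refine ⟨by simpa using hZ.mul_mul_conjTranspose_same V, fun i => ?_⟩
  rw [frob_conj, ← constraintMap_apply A V Z i, hb]

/-! ## §3 `Λ ≻ 0 ⇒ Λ ± εΔ ≻ 0` for small `ε` -/

/-- Matrices with positive quadratic form (no symmetry imposed) — an auxiliary open set. [folklore] -/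
private def quadPos (ρ : Type*) [Fintype ρ] : Set (Matrix ρ ρ ℝ) := {X | ∀ v : ρ → ℝ, v ≠ 0 → 0 < v ⬝ᵥ (X *ᵥ v)}

/-- Joint continuity of `(X, v) ↦ vᵀXv`. [folklore] -/
private theorem continuous_quad :
    Continuous fun p : Matrix ρ ρ ℝ × (ρ → ℝ) => p.2 ⬝ᵥ (p.1 *ᵥ p.2) :=
  Continuous.dotProduct continuous_snd (Continuous.matrix_mulVec continuous_fst continuous_snd)

/-- `quadPos` is tested on the (compact) unit sphere of the sup norm. [folklore] -/
private theorem mem_quadPos_iff_sphere {X : Matrix ρ ρ ℝ} :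
    X ∈ quadPos ρ ↔ ∀ v ∈ Metric.sphere (0 : ρ → ℝ) 1, 0 < v ⬝ᵥ (X *ᵥ v) := by
  constructor
  · intro hX v hv
    refine hX v ?_
    intro h0
    rw [h0] at hv
    simp at hv
  · intro h v hv
    have hnv : 0 < ‖v‖ := norm_pos_iff.mpr hv
    have hu : ‖v‖⁻¹ • v ∈ Metric.sphere (0 : ρ → ℝ) 1 := by
      rw [mem_sphere_zero_iff_norm, norm_smul, norm_inv, norm_norm, inv_mul_cancel₀ hnv.ne']
    have := h _ hu
    rw [mulVec_smul, dotProduct_smul, smul_dotProduct, smul_eq_mul, smul_eq_mul] at this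
    have hq : 0 < ‖v‖⁻¹ * (‖v‖⁻¹ * (v ⬝ᵥ (X *ᵥ v))) := this
    by_contra hle
    have hle : v ⬝ᵥ (X *ᵥ v) ≤ 0 := not_lt.mp hle
    have : ‖v‖⁻¹ * (‖v‖⁻¹ * (v ⬝ᵥ (X *ᵥ v))) ≤ 0 :=
      mul_nonpos_of_nonneg_of_nonpos (inv_nonneg.mpr hnv.le)
        (mul_nonpos_of_nonneg_of_nonpos (inv_nonneg.mpr hnv.le) hle)
    exact absurd hq (not_lt.mpr this)

/-- `quadPos` is open (tube lemma over the compact unit sphere). [folklore] -/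
private theorem isOpen_quadPos : IsOpen (quadPos ρ) := by
  rw [isOpen_iff_eventually]
  intro X₀ hX₀
  have hK : IsCompact (Metric.sphere (0 : ρ → ℝ) 1) := isCompact_sphere 0 1
  have hP : ∀ v ∈ Metric.sphere (0 : ρ → ℝ) 1,
      ∀ᶠ z : Matrix ρ ρ ℝ × (ρ → ℝ) in nhds (X₀, v), 0 < z.2 ⬝ᵥ (z.1 *ᵥ z.2) := by
    intro v hv
    have hpos : 0 < v ⬝ᵥ (X₀ *ᵥ v) := (mem_quadPos_iff_sphere.mp hX₀) v hv
    exact (isOpen_lt continuous_const continuous_quad).mem_nhds hpos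
  have hev := hK.eventually_forall_of_forall_eventually
    (P := fun (X : Matrix ρ ρ ℝ) (v : ρ → ℝ) => 0 < v ⬝ᵥ (X *ᵥ v)) hP
  exact hev.mono fun X hX => mem_quadPos_iff_sphere.mpr hX

omit [Fintype ρ] in
/-- Real multiples of a symmetric matrix are symmetric. [folklore] -/
private theorem isHermitian_smul_real {Δ : Matrix ρ ρ ℝ} (hΔ : Δ.IsHermitian) (t : ℝ) : (t • Δ).IsHermitian := by
  unfold Matrix.IsHermitian at hΔ ⊢
  rw [conjTranspose_smul, star_trivial, hΔ]

/-- "Since `Λ` is positive definite, there exists `ε > 0` such that `Λ ± εDⱼ ⪰ 0`" — indeed `≻ 0`, for any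
symmetric direction `Δ`. [cite: Pataki1998, §2 proof of Thm. 2.1, between (2.5) and (2.6)] -/
theorem exists_posDef_add_sub_smul {Λ Δ : Matrix ρ ρ ℝ} (hΛ : Λ.PosDef) (hΔ : Δ.IsHermitian) :
    ∃ ε : ℝ, 0 < ε ∧ (Λ + ε • Δ).PosDef ∧ (Λ - ε • Δ).PosDef := by
  let g : ℝ → Matrix ρ ρ ℝ := fun t => Λ + t • Δ
  have hg : Continuous g := continuous_const.add (continuous_id.smul continuous_const)
  have hO : IsOpen (g ⁻¹' quadPos ρ) := isOpen_quadPos.preimage hg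
  have h0 : (0 : ℝ) ∈ g ⁻¹' quadPos ρ := by
    show Λ + (0 : ℝ) • Δ ∈ quadPos ρ
    rw [zero_smul, add_zero]
    intro v hv
    simpa using hΛ.dotProduct_mulVec_pos hv
  obtain ⟨δ, hδ, hball⟩ := Metric.isOpen_iff.mp hO 0 h0
  have hpd : ∀ t : ℝ, |t| < δ → (Λ + t • Δ).PosDef := by
    intro t ht
    have hmem : Λ + t • Δ ∈ quadPos ρ := hball (by simpa [Real.dist_eq] using ht)
    exact PosDef.of_dotProduct_mulVec_pos (hΛ.isHermitian.add (isHermitian_smul_real hΔ t))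
      fun v hv => by simpa using hmem v hv
  refine ⟨δ / 2, half_pos hδ, hpd _ ?_, ?_⟩
  · rw [abs_of_pos (half_pos hδ)]
    linarith
  · have := hpd (-(δ / 2)) (by rw [abs_neg, abs_of_pos (half_pos hδ)]; linarith)
    rwa [neg_smul, ← sub_eq_add_neg] at this

/-! ## §4 Theorem 2.1 (1) at an extreme point -/

/-- THE PERTURBATION ARGUMENT (2.5)–(2.6): if `VΛVᵀ` is feasible with `Λ ≻ 0`, `LV = 1`, and `Δ ≠ 0` is a symmetric
solution of the homogeneous reduced system `⟨VᵀAᵢV, Δ⟩ = 0`, then `VΛVᵀ` lies in the open segment between the two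
DISTINCT feasible points `X_± = V(Λ ± εΔ)Vᵀ` — so it is not an extreme point.
[cite: Pataki1998, §2 proof of Thm. 2.1, eqs. (2.5)–(2.6)] -/
theorem exists_ne_of_ker [DecidableEq ρ] {A : ι → Matrix n n ℝ} {b : ι → ℝ} {V : Matrix n ρ ℝ} {L : Matrix ρ n ℝ}
    {Λ Δ : Matrix ρ ρ ℝ} (hLV : L * V = 1) (hΛ : Λ.PosDef) (hX : V * Λ * Vᵀ ∈ feasibleSet A b)
    (hΔ : Δ.IsHermitian) (hΔ0 : Δ ≠ 0) (hker : constraintMap A V Δ = 0) :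
    ∃ X₁ ∈ feasibleSet A b, ∃ X₂ ∈ feasibleSet A b, X₁ ≠ X₂ ∧ V * Λ * Vᵀ ∈ openSegment ℝ X₁ X₂ := by
  obtain ⟨ε, hε, hp, hm⟩ := exists_posDef_add_sub_smul hΛ hΔ
  have hb : constraintMap A V Λ = b := constraintMap_eq_of_mem hX
  set P : Matrix n n ℝ := V * Δ * Vᵀ with hP
  have hP0 : P ≠ 0 := by
    intro h0
    apply hΔ0
    calc Δ = (L * V) * Δ * (L * V)ᵀ := by rw [hLV]; simp
      _ = L * P * Lᵀ := by simp [hP, Matrix.mul_assoc, transpose_mul]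
      _ = 0 := by rw [h0]; simp
  have h₁ : V * (Λ + ε • Δ) * Vᵀ = V * Λ * Vᵀ + ε • P := by
    simp [hP, Matrix.mul_add, Matrix.add_mul, Matrix.mul_smul, Matrix.smul_mul]
  have h₂ : V * (Λ - ε • Δ) * Vᵀ = V * Λ * Vᵀ - ε • P := by
    simp [hP, Matrix.mul_sub, Matrix.sub_mul, Matrix.mul_smul, Matrix.smul_mul]
  have hb₁ : constraintMap A V (Λ + ε • Δ) = b := by
    rw [map_add, map_smul, hker, smul_zero, add_zero, hb]
  have hb₂ : constraintMap A V (Λ - ε • Δ) = b := by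
    rw [map_sub, map_smul, hker, smul_zero, sub_zero, hb]
  have hne : V * (Λ + ε • Δ) * Vᵀ ≠ V * (Λ - ε • Δ) * Vᵀ := by
    rw [h₁, h₂]
    intro h
    have h2 : (2 * ε) • P = 0 := by
      rw [mul_smul, two_smul]
      calc ε • P + ε • P = (V * Λ * Vᵀ + ε • P) - (V * Λ * Vᵀ - ε • P) := by abel
        _ = 0 := by rw [h, sub_self]
    rcases smul_eq_zero.mp h2 with h' | h'
    · exact absurd h' (by positivity)
    · exact hP0 h'
  have hseg : V * Λ * Vᵀ ∈ openSegment ℝ (V * (Λ + ε • Δ) * Vᵀ) (V * (Λ - ε • Δ) * Vᵀ) := by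
    rw [h₁, h₂]
    refine ⟨1 / 2, 1 / 2, by norm_num, by norm_num, by norm_num, ?_⟩
    module
  exact ⟨_, conj_mem_feasibleSet hp.posSemidef hb₁, _, conj_mem_feasibleSet hm.posSemidef hb₂, hne, hseg⟩

/-- AT AN EXTREME POINT the homogeneous reduced system has only the trivial symmetric solution: `X = VΛVᵀ` extreme
in `𝓕`, `LV = 1`, `Λ ≻ 0`, `Δ ∈ S^ρ`, `⟨VᵀAᵢV, Δ⟩ = 0 ∀ i` ⇒ `Δ = 0` ("Since F is a face … we obtain
dim F ≥ d + 1, a contradiction", with `d = 0`). [cite: Pataki1998, Thm. 2.1 (1), proof (2.3)–(2.6)] -/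
theorem eq_zero_of_mem_extremePoints [DecidableEq ρ] {A : ι → Matrix n n ℝ} {b : ι → ℝ} {V : Matrix n ρ ℝ}
    {L : Matrix ρ n ℝ}
    {Λ Δ : Matrix ρ ρ ℝ} (hLV : L * V = 1) (hΛ : Λ.PosDef)
    (hX : V * Λ * Vᵀ ∈ (feasibleSet A b).extremePoints ℝ)
    (hΔ : Δ.IsHermitian) (hker : constraintMap A V Δ = 0) : Δ = 0 := by
  by_contra hΔ0
  rw [mem_extremePoints] at hX
  obtain ⟨X₁, h₁, X₂, h₂, hne, hseg⟩ := exists_ne_of_ker hLV hΛ hX.1 hΔ hΔ0 hker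
  obtain ⟨e₁, e₂⟩ := hX.2 X₁ h₁ X₂ h₂ hseg
  exact hne (e₁.trans e₂.symm)

/-- Hence at an extreme point the linear map `ℝ^{t(r)} → ℝ^ι`, `e ↦ (⟨VᵀAᵢV, symOf e⟩)ᵢ`, is injective.
[cite: Pataki1998, Thm. 2.1 (1), proof (2.3)–(2.6)] -/
theorem injective_constraintMap_comp_symOf {A : ι → Matrix n n ℝ} {b : ι → ℝ} {r : ℕ} {V : Matrix n (Fin r) ℝ}
    {L : Matrix (Fin r) n ℝ} {Λ : Matrix (Fin r) (Fin r) ℝ} (hLV : L * V = 1) (hΛ : Λ.PosDef)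
    (hX : V * Λ * Vᵀ ∈ (feasibleSet A b).extremePoints ℝ) :
    Function.Injective ((constraintMap A V).comp (symOfLin r)) := by
  rw [← LinearMap.ker_eq_bot, LinearMap.ker_eq_bot']
  intro e he
  have h0 : symOf e = 0 :=
    eq_zero_of_mem_extremePoints hLV hΛ hX (isHermitian_symOf e) (by simpa using he)
  have hz : symOf (0 : UpperPair r → ℝ) = 0 := map_zero (symOfLin r)
  exact symOf_injective r (h0.trans hz.symm)

/-- **Pataki 1998, Theorem 2.1 (1) at an extreme point: `t(rank X) ≤ m`.** If `X = VΛVᵀ` with `Λ ≻ 0` of order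
`r` and `V` of full column rank (`LV = 1`), and `X` is an extreme point of `𝓕 = {X ⪰ 0 : ⟨Aᵢ, X⟩ = bᵢ}`, then
`r(r+1)/2 ≤ |ι|`. [cite: Pataki1998, Thm. 2.1 (1) (case d = 0)] -/
theorem tri_le_card_of_mem_extremePoints [Fintype ι] {A : ι → Matrix n n ℝ} {b : ι → ℝ} {r : ℕ} {V : Matrix n (Fin r) ℝ}
    {L : Matrix (Fin r) n ℝ} {Λ : Matrix (Fin r) (Fin r) ℝ} (hLV : L * V = 1) (hΛ : Λ.PosDef)
    (hX : V * Λ * Vᵀ ∈ (feasibleSet A b).extremePoints ℝ) : tri r ≤ Fintype.card ι := by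
  have := LinearMap.finrank_le_finrank_of_injective (injective_constraintMap_comp_symOf hLV hΛ hX)
  simpa [Module.finrank_fintype_fun_eq_card, card_upperPair] using this

/-- The same bound without the division: `r(r+1) ≤ 2|ι|`. [cite: Pataki1998, Thm. 2.1 (1) (case d = 0)] -/
theorem rank_mul_succ_le_two_mul_card [Fintype ι] {A : ι → Matrix n n ℝ} {b : ι → ℝ} {r : ℕ} {V : Matrix n (Fin r) ℝ}
    {L : Matrix (Fin r) n ℝ} {Λ : Matrix (Fin r) (Fin r) ℝ} (hLV : L * V = 1) (hΛ : Λ.PosDef)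
    (hX : V * Λ * Vᵀ ∈ (feasibleSet A b).extremePoints ℝ) : r * (r + 1) ≤ 2 * Fintype.card ι := by
  rw [← two_mul_tri]
  exact Nat.mul_le_mul_left 2 (tri_le_card_of_mem_extremePoints hLV hΛ hX)

/-- With a single linear constraint (`|ι| ≤ 1`, e.g. the spectraplex `{X ⪰ 0 : tr X = 1}`) every extreme point so
presented has rank `r ≤ 1` (`t(2) = 3 > 1`). [cite: Pataki1998, Thm. 2.1 (1) (case d = 0, m = 1)] -/
theorem rank_le_one_of_card_le_one [Fintype ι] {A : ι → Matrix n n ℝ} {b : ι → ℝ} {r : ℕ} {V : Matrix n (Fin r) ℝ}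
    {L : Matrix (Fin r) n ℝ} {Λ : Matrix (Fin r) (Fin r) ℝ} (hLV : L * V = 1) (hΛ : Λ.PosDef)
    (hX : V * Λ * Vᵀ ∈ (feasibleSet A b).extremePoints ℝ) (hι : Fintype.card ι ≤ 1) : r ≤ 1 := by
  have h := rank_mul_succ_le_two_mul_card hLV hΛ hX
  by_contra hr
  have hr : 2 ≤ r := by omega
  have : 2 * 3 ≤ r * (r + 1) := Nat.mul_le_mul hr (by omega)
  omega

/-! ## §5 The purification step (contrapositive with the dimension count) -/

/-- PURIFICATION: if `VΛVᵀ` is feasible with `Λ ≻ 0` of order `r`, `LV = 1`, and `t(r) > |ι|`, then the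
homogeneous reduced system has a non-zero symmetric solution ("The system (2.4) is determined by `m` equations,
and `dim S^r = t(r)`. Hence there exist … `D₁, …, D_{d+1} ∈ S^r`"), so `VΛVᵀ` is the midpoint of two distinct
feasible points. [cite: Pataki1998, §2 proof of Thm. 2.1, (2.4)–(2.6)] -/
theorem exists_ne_of_card_lt_tri [Fintype ι] {A : ι → Matrix n n ℝ} {b : ι → ℝ} {r : ℕ} {V : Matrix n (Fin r) ℝ}
    {L : Matrix (Fin r) n ℝ} {Λ : Matrix (Fin r) (Fin r) ℝ} (hLV : L * V = 1) (hΛ : Λ.PosDef)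
    (hX : V * Λ * Vᵀ ∈ feasibleSet A b) (hlt : Fintype.card ι < tri r) :
    ∃ X₁ ∈ feasibleSet A b, ∃ X₂ ∈ feasibleSet A b, X₁ ≠ X₂ ∧ V * Λ * Vᵀ ∈ openSegment ℝ X₁ X₂ := by
  have hdim : Module.finrank ℝ (ι → ℝ) < Module.finrank ℝ (UpperPair r → ℝ) := by
    simpa [Module.finrank_fintype_fun_eq_card, card_upperPair] using hlt
  have hker := LinearMap.ker_ne_bot_of_finrank_lt (f := (constraintMap A V).comp (symOfLin r)) hdim
  obtain ⟨e, he, hne⟩ := Submodule.exists_mem_ne_zero_of_ne_bot hker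
  have hz : symOf (0 : UpperPair r → ℝ) = 0 := map_zero (symOfLin r)
  have hΔ0 : symOf e ≠ 0 := fun h => hne (symOf_injective r (h.trans hz.symm))
  exact exists_ne_of_ker hLV hΛ hX (isHermitian_symOf e) hΔ0 (by simpa using he)

/-- … in particular such a point is NOT extreme (contrapositive of Theorem 2.1 (1)).
[cite: Pataki1998, Thm. 2.1 (1) (case d = 0)] -/
theorem not_mem_extremePoints_of_card_lt_tri [Fintype ι] {A : ι → Matrix n n ℝ} {b : ι → ℝ} {r : ℕ} {V : Matrix n (Fin r) ℝ}
    {L : Matrix (Fin r) n ℝ} {Λ : Matrix (Fin r) (Fin r) ℝ} (hLV : L * V = 1) (hΛ : Λ.PosDef)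
    (hlt : Fintype.card ι < tri r) : V * Λ * Vᵀ ∉ (feasibleSet A b).extremePoints ℝ :=
  fun h => absurd (tri_le_card_of_mem_extremePoints hLV hΛ h) (not_le.mpr hlt)

/-! ## §6 Example: the spectraplex of order 2 -/

/-- The single constraint `tr X = 1` on `S²`: data `A = (I₂)`. [cite: Pataki1998, §1 (1.1) (instance m = 1, A₁ = I)] -/
def spxA : Unit → Matrix (Fin 2) (Fin 2) ℝ := fun _ => 1

/-- … and right-hand side `b = (1)`. [cite: Pataki1998, §1 (1.1) (instance m = 1, b₁ = 1)] -/
def spxb : Unit → ℝ := fun _ => 1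

/-- The barycentre `½ I₂` of the spectraplex `{X ⪰ 0 : tr X = 1} ⊆ S²` is feasible …
[cite: Pataki1998, §1 (1.1) (instance m = 1)] -/
theorem spx_half_mem : (1 / 2 : ℝ) • (1 : Matrix (Fin 2) (Fin 2) ℝ) ∈ feasibleSet spxA spxb := by
  refine ⟨PosSemidef.one.smul (by norm_num), fun _ => ?_⟩
  simp [spxA, spxb, frob, trace_smul, Matrix.trace_one]

/-- … but NOT an extreme point: it is `VΛVᵀ` with `V = L = I₂`, `Λ = ½ I₂ ≻ 0` of order `r = 2`, and
`t(2) = 3 > 1 = m` (Theorem 2.1 (1) in the contrapositive; indeed `½I₂ = ½E₁₁ + ½E₂₂`).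
[cite: Pataki1998, Thm. 2.1 (1) (case d = 0, instance m = 1, r = 2)] -/
theorem spx_half_not_mem_extremePoints :
    (1 / 2 : ℝ) • (1 : Matrix (Fin 2) (Fin 2) ℝ) ∉ (feasibleSet spxA spxb).extremePoints ℝ := by
  have hΛ : ((1 / 2 : ℝ) • (1 : Matrix (Fin 2) (Fin 2) ℝ)).PosDef := PosDef.one.smul (by norm_num)
  have hLV : (1 : Matrix (Fin 2) (Fin 2) ℝ) * 1 = 1 := Matrix.mul_one 1
  have hlt : Fintype.card Unit < tri 2 := by decide
  have h := not_mem_extremePoints_of_card_lt_tri (A := spxA) (b := spxb) hLV hΛ hlt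
  simpa using h

/-! ## §7 Example: correlation matrices (the elliptope) -/

section elliptope

variable [DecidableEq n]

/-- The `n` diagonal constraints `X_{ii} = 1` of the elliptope `{X ⪰ 0 : X_{ii} = 1}` (correlation matrices):
data `Aᵢ = Eᵢᵢ`. [cite: Pataki1998, §1 (1.1) (instance m = n, Aᵢ = Eᵢᵢ)] -/
def ellA (n : Type*) [DecidableEq n] : n → Matrix n n ℝ := fun i => Matrix.single i i 1

/-- … with right-hand sides `bᵢ = 1`. [cite: Pataki1998, §1 (1.1) (instance m = n, bᵢ = 1)] -/
def ellb (n : Type*) : n → ℝ := fun _ => 1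

/-- `⟨Eᵢᵢ, X⟩ = X_{ii}`. [cite: Pataki1998, §1 (1.1) (instance Aᵢ = Eᵢᵢ: the constraint reads X_{ii} = bᵢ)] -/
theorem frob_single_diag (i : n) (X : Matrix n n ℝ) : frob (Matrix.single i i 1) X = X i i := by
  unfold frob Matrix.trace
  rw [Finset.sum_eq_single i]
  · simp
  · intro j _ hj
    simp [Matrix.diag, hj]
  · simp

/-- The elliptope as a feasible set of (1.1): `X ∈ 𝓕(ellA, ellb) ↔ X ⪰ 0 ∧ ∀ i, X_{ii} = 1`.
[cite: Pataki1998, §1 (1.1) (instance m = n, Aᵢ = Eᵢᵢ, bᵢ = 1)] -/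
theorem mem_elliptope_iff {X : Matrix n n ℝ} :
    X ∈ feasibleSet (ellA n) (ellb n) ↔ X.PosSemidef ∧ ∀ i, X i i = 1 := by
  simp only [mem_feasibleSet_iff, ellA, ellb, frob_single_diag]

/-- **Rank of extreme correlation matrices**: an extreme point of the elliptope of order `n` presented as
`VΛVᵀ` (`Λ ≻ 0` of order `r`, `LV = 1`) has `t(r) = r(r+1)/2 ≤ n` — Theorem 2.1 (1) with `m = n`.
[cite: Pataki1998, Thm. 2.1 (1) (case d = 0, instance Aᵢ = Eᵢᵢ, bᵢ = 1, m = n)] -/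
theorem elliptope_tri_le_card {r : ℕ} {V : Matrix n (Fin r) ℝ} {L : Matrix (Fin r) n ℝ}
    {Λ : Matrix (Fin r) (Fin r) ℝ} (hLV : L * V = 1) (hΛ : Λ.PosDef)
    (hX : V * Λ * Vᵀ ∈ (feasibleSet (ellA n) (ellb n)).extremePoints ℝ) : tri r ≤ Fintype.card n :=
  tri_le_card_of_mem_extremePoints hLV hΛ hX

end elliptope

end Literature.Computation.Certificates.PatakiRankBound
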